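import Summits.Ventures.PercRepro.RankLevelSetLevelFiveArithB
import Summits.Ventures.PercRepro.S1CoreFourCircuitSum

/-!
# PercRepro — S2: THE `p = 21` CELLS OF THE «22» KIT — T⁺⁺⁺ / T4⁺, THE SET-BASED GIANT TERM, THE RANK-`4` TAIL BY THE SET-INDEXED COUNT (p7, gen 3; sub-claim S2)

The cell inequalities of `ThmN.c025_core_five_sharp_cell_xq` (S2SharpCoreXQ) at `p = 21`, coranks [6]: the polynomial side
`1024·U′(21, d) ≤ (1024 − m_d)·2^(d−5)·C(26, 5)` and the tail side `1024·T″(21 + d, d) ≤ m_d·2^(21+d)` with the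
rank-`4` sets of the tail counted by the set-indexed count at level `4` (`C(n,4) + σ·(s₃·C(n−3,2) + s₄·(n−4) + s₅) + (σ_g − σ)·C(10,5)`
in place of `64·C(n, 4)`), `m_d = ⌈1024·T″/2^n⌉`. Numeral checks. Axioms: standard.
-/

namespace PercRepro

namespace S2

/-- The cell `(21, 6)`, polynomial side, slack `6/1024`. -/
theorem cellP21XQ_poly_6 :
    1024 * (((21 + 6).choose 5 : ℚ) +
      (∑ j ∈ Finset.range (6 - 5), (Nat.choose (min 13 ((6 + 6) / 2 + 1 - 2)) j : ℚ) / (((j + 1) + 3 * (j + 1).choose 2 : ℕ) : ℚ)) *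
        ((((6 * 6 + 6 - 3 * 6) / 2) * (21 + 6 - 3).choose 3 + S1.fourCircuitBound 6 * (21 + 6 - 4).choose 2 + (6 + 4).choose 5 * (21 + 6 - 5) + (6 + 5).choose 6 : ℕ) : ℚ) +
      ((∑ j ∈ Finset.range (6 - 5), (Nat.choose (min 19 (5 + 6) - 6) j : ℚ) / (((j + 1) + 3 * (j + 1).choose 2 : ℕ) : ℚ)) -
        (∑ j ∈ Finset.range (6 - 5), (Nat.choose (min 13 ((6 + 6) / 2 + 1 - 2)) j : ℚ) / (((j + 1) + 3 * (j + 1).choose 2 : ℕ) : ℚ))) *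
        ((min 19 (5 + 6)).choose 6 : ℚ)) ≤
      ((1024 - 6 : ℕ) : ℚ) * 2 ^ (6 - 5) * ((21 + 5).choose 5 : ℚ) := by
  norm_num [Finset.sum_range_succ, Nat.choose, S1.fourCircuitBound, S1.perPointBound]

/-- The cell `(21, 6)`, tail side, slack `6/1024` (`n = 27`; the rank-`4` sets by the level-`4` set count). -/
theorem cellP21XQ_tail_6 :
    1024 * (((21 + 6).choose 4 : ℚ) +
      (∑ j ∈ Finset.range 6, (Nat.choose (min 5 ((6 + 3) / 2 + 1 - 2)) j : ℚ) / (((j + 1) + 3 * (j + 1).choose 2 : ℕ) : ℚ)) *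
        ((((6 * 6 + 6 - 3 * 6) / 2) * (21 + 6 - 3).choose 2 + S1.fourCircuitBound 6 * (21 + 6 - 4) + (6 + 4).choose 5 : ℕ) : ℚ) +
      ((∑ j ∈ Finset.range 6, (Nat.choose 5 j : ℚ) / (((j + 1) + 3 * (j + 1).choose 2 : ℕ) : ℚ)) -
        (∑ j ∈ Finset.range 6, (Nat.choose (min 5 ((6 + 3) / 2 + 1 - 2)) j : ℚ) / (((j + 1) + 3 * (j + 1).choose 2 : ℕ) : ℚ))) *
        ((10 : ℕ).choose 5 : ℚ) +
      (((21 + 6).choose 3 * 2 ^ 3 + (21 + 6).choose 2 * 2 + (21 + 6) + 1 : ℕ) : ℚ) +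
      (((21 + 6).choose 5 : ℚ) + (∑ j ∈ Finset.range (6), (Nat.choose (min 13 ((6 + 6) / 2 + 1 - 2)) j : ℚ) / (((j + 1) + 3 * (j + 1).choose 2 : ℕ) : ℚ)) * ((((6 * 6 + 6 - 3 * 6) / 2) * (21 + 6 - 3).choose 3 + S1.fourCircuitBound 6 * (21 + 6 - 4).choose 2 + (6 + 4).choose 5 * (21 + 6 - 5) + (6 + 5).choose 6 : ℕ) : ℚ) +
        ((∑ j ∈ Finset.range (6), (Nat.choose (min 19 (5 + 6) - 6) j : ℚ) / (((j + 1) + 3 * (j + 1).choose 2 : ℕ) : ℚ)) - (∑ j ∈ Finset.range (6), (Nat.choose (min 13 ((6 + 6) / 2 + 1 - 2)) j : ℚ) / (((j + 1) + 3 * (j + 1).choose 2 : ℕ) : ℚ))) * ((min 19 (5 + 6)).choose 6 : ℚ)) +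
      ((∑ j ∈ Finset.range (6 + 1), (21 + 6).choose j : ℕ) : ℚ)) ≤ (6 : ℚ) * 2 ^ (21 + 6) := by
  have hsm : (∑ j ∈ Finset.range (6), (Nat.choose (min 13 ((6 + 6) / 2 + 1 - 2)) j : ℚ) / (((j + 1) + 3 * (j + 1).choose 2 : ℕ) : ℚ)) = 9033 / 2618 := by
    norm_num [Finset.sum_range_succ, Nat.choose]
  have hsg : (∑ j ∈ Finset.range (6), (Nat.choose (min 19 (5 + 6) - 6) j : ℚ) / (((j + 1) + 3 * (j + 1).choose 2 : ℕ) : ℚ)) = 9033 / 2618 := by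
    norm_num [Finset.sum_range_succ, Nat.choose]
  have hs4m : (∑ j ∈ Finset.range 6, (Nat.choose (min 5 ((6 + 3) / 2 + 1 - 2)) j : ℚ) / (((j + 1) + 3 * (j + 1).choose 2 : ℕ) : ℚ)) = 417 / 220 := by
    norm_num [Finset.sum_range_succ, Nat.choose]
  have hs4g : (∑ j ∈ Finset.range 6, (Nat.choose 5 j : ℚ) / (((j + 1) + 3 * (j + 1).choose 2 : ℕ) : ℚ)) = 9033 / 2618 := by
    norm_num [Finset.sum_range_succ, Nat.choose]
  rw [hsm, hsg, hs4m, hs4g]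
  simp only [Finset.sum_range_succ, Finset.sum_range_zero]
  norm_num [Nat.choose, S1.fourCircuitBound, S1.perPointBound]

end S2

end PercRepro
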